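import Literature.NumberTheory.Automorphic.Liu2021.AppendixC.JacobianHeckeEntryLevelAdjoint
import Literature.NumberTheory.Automorphic.Liu2021.AppendixC.HeckeWordPieceIndexMatching
import HarnessLib

/-!
# One entry of the transposed Hecke word, PACKAGED: the level adjoint `fd` of the entry `q₁^* ≫ Nm_T` identified with the brick's
# entry in `End(Y_K)` (Mumford §20 (3); Lange–Rodríguez (3.3), Prop. 3.5.1)

Topic `NumberTheory/Automorphic/Liu2021/AppendixC`; namespace `Literature.NumberTheory.Automorphic.Liu2021.AppendixC`.
PROOF FILE (theorems only; no definition, no named fact, no instance, no `sorry`).  Generic over complex curves; the named fact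
(F-P2) ★ `Jacobian.galoisCover_pullback_isWeilPairingAdjoint_norm` is a per-theorem hypothesis.  Sequel of ★
`JacobianHeckeEntryLevelAdjoint` (ed. 2, `Jacobian.exists_entry_levelAdjoint_smul`: the pair `(#H_q • (((m:ℤ)•tt) ≫ Nm_{tp}), (m:ℤ) • (tz ≫ Nm_q ≫ Nm_{tu}))`)
and ★ `HeckeWordPieceIndexMatching` (`fan_entry_eq_of_pinned_of_index_eq_smul`: two pinned rows into the same piece and two piece maps
over one ambient map give the same `End(Y_K)`-entry).

THE SITUATION (cell `hodgecm-mathlib`, d6 `stub_RosH` glue, (G4Σ) Layer 2 — the geometric half feeding ★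
`Sec42Data.HeckeTranslates.transposedWord_package_of_bricks`).  Index `i = (γ, c′)` of the (hx) fan word, chosen piece `z = ch c′` of
`X_{N″_γ} ⊗ ℂ`.  K-level pieces `E_K a` (targets of the T_γ-piece; `a₂ = φ γ c′`, and `a₁ = b″ z` the brick's row index, `a₁ = a₂`) and
`E_K d` (sources; `d₂ = bN c′`, and `d₁ = φ″ z` the brick's column index, `d₁ = d₂`); the N-piece `X_c = E_N c′`, the N″-piece `X_z = E″ z`;
the Galois piece covers `tu : X_c → E_K d₂` (group `H_u`, pinned pull-back `ttH`), `q : X_z → X_c` (group `H_q`) and the brick's `u″`-piece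
`p₁ : X_z → E_K a₁` (group `H_z`, pinned row `x₁ = ttH″ z`) lying over the same ambient map as `q ≫ tp`; the brick's translate piece
`r₁ : X_z → E_K d₁` over the same ambient map as `q ≫ tu`; the trace multiplicity `m₀`.  OUTPUT `Jacobian.exists_entry_package`:
`∃ fd : J_K a₂ → J_K d₂` with

  (hfd)  `πY_K a₁ ≫ ((m₀:ℤ) • (x₁ ≫ Nm_{r₁})) ≫ ιY_K d₁ = πY_K a₂ ≫ fd ≫ ιY_K d₂`      (the brick's entry IS `fd`, in `End(Y_K)`),
  (hf)   `ē_n^{W_K a₂}((#H_q • (((m₀:ℤ)•ttH) ≫ Nm_{tp})) P, Q) = ē_n^{W_K d₂}(P, fd Q)`  (level-adjoint pair of raw weight `#H_q`),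

namely `fd := (m₀:ℤ) • (tz ≫ Nm_q ≫ Nm_{tu})` for the pull-back `tz` of `q ≫ tp` pinned by `H_z` (★ ed. 2), matched with `x₁` by the common pin
(★ `fan_entry_eq_of_pinned_of_index_eq_smul`, ★ `isSepQuotient_pieceMap_of_index_eq`).  §0 `zsmul_comp_pushforward_eq` is the one-line
reshaping `((m:ℤ) • x) ≫ Nm_r = (m:ℤ) • (x ≫ Nm_r)`.

COUNT-NEUTRAL capital: HC_CM is proved only modulo the 7 printed citations until rung 0 closes; conditional on (F-P2) as ★ ed. 2 is.

## References
* [MumfordAV1970] D. Mumford, *Abelian Varieties* (1970), §20 p. 186, property (3) of `e_n`; §19 (Hom(X,Y), first paragraph).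
* [LangeRodriguez2022] H. Lange, R. E. Rodríguez, *Decomposition of Jacobians by Prym Varieties*, LNM 2310 (2022), §3.2.1 eq. (3.3)
  (pp. 46–47), §3.5.1 Prop. 3.5.1 (p. 65).
* [Lange2023AbelianVarietiesComplex] H. Lange, *Abelian Varieties over the Complex Numbers* (2023), §4.5.2 (the norm map `N_f`).
* [GortzWedhorn2020] U. Görtz, T. Wedhorn, *Algebraic Geometry I* (2nd ed.), §(3.5) Prop. 3.10, Example 3.11 (p. 73).
-/

set_option autoImplicit false

noncomputable section

open CategoryTheory AlgebraicGeometry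
open Literature.AlgebraicGeometry.Motives Literature.AlgebraicGeometry.Motives.AbelianVariety

universe u

namespace Literature.NumberTheory.Automorphic.Liu2021.AppendixC

/-! ## §0 Reshaping an integer multiplicity through a norm map -/

/-- `((m : ℤ) • x) ≫ Nm_r = (m : ℤ) • (x ≫ Nm_r)` (bilinearity of composition). [cite: MumfordAV1970, §19 (Hom(X,Y), first paragraph)] -/
theorem zsmul_comp_pushforward_eq {L : Type u} [Field L] {A B C : AbelianVariety L} (x : A ⟶ B) (y : B ⟶ C) (m : ℤ) :
    (m • x) ≫ y = m • (x ≫ y) :=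
  Preadditive.zsmul_comp _ _ _

/-! ## §1 The entry package -/

/-- **ONE ENTRY OF THE TRANSPOSED HECKE WORD, PACKAGED** ((G4Σ) Layer 2, per index `i = (γ, c′)` with chosen piece `z`).  Data as in the
module docstring: the monomorphic K-level cofan legs `e_K`, Jacobians `J_K`, fan legs `πY_K`, `ιY_K`, K-level thetas `W_K`; indices
`a₁ = a₂` (row) and `d₁ = d₂` (column); curves `E_K a₂`, `X_c`, `X_z`, `E_K d₂` smooth projective with Jacobians (`dim ≥ 1` for the three of
★ ed. 2) and Riemann theta divisors; Galois piece covers `tu : X_c → E_K d₂` (`H_u`, pinned `ttH`), `q : X_z → X_c` (`H_q`) and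
`p₁ : X_z → E_K a₁` (`H_z`, quotient, pinned row `x₁`) with `p₁ ≫ e_K a₁ = (q ≫ tp) ≫ e_K a₂` for the T_γ-piece `tp : X_c → E_K a₂`;
the translate piece `r₁ : X_z → E_K d₁` with `r₁ ≫ e_K d₁ = (q ≫ tu) ≫ e_K d₂`; a multiplicity `m₀`.  Then
`∃ fd : J_K a₂ → J_K d₂` with `πY_K a₁ ≫ ((m₀:ℤ) • (x₁ ≫ Nm_{r₁})) ≫ ιY_K d₁ = πY_K a₂ ≫ fd ≫ ιY_K d₂` and the level-adjoint pair
`ē_n^{W_K a₂}((#H_q • (((m₀:ℤ)•ttH) ≫ Nm_{tp})) P, Q) = ē_n^{W_K d₂}(P, fd Q)` at every level — `fd := (m₀:ℤ) • (tz ≫ Nm_q ≫ Nm_{tu})` for the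
`H_z`-pinned pull-back `tz` of `q ≫ tp` (★ `Jacobian.exists_entry_levelAdjoint_smul`), equal to the brick's entry through the common pin
`Σ_{h ∈ H_z} h_*` (★ `fan_entry_eq_of_pinned_of_index_eq_smul`; the quotient property of `p₁` transported along `a₁ = a₂` by ★
`isSepQuotient_pieceMap_of_index_eq`). [cite: MumfordAV1970, §20 (p. 186, property (3) of e_n)]
[cite: LangeRodriguez2022, §3.2.1 eq. (3.3) (pp. 46–47); §3.5.1 Prop. 3.5.1 (p. 65)] [cite: Lange2023AbelianVarietiesComplex, §4.5.2 (the norm map N_f)]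
[cite: GortzWedhorn2020, §(3.5) Proposition 3.10 and Example 3.11 (p. 73)] -/
theorem Jacobian.exists_entry_package (hFP2 : Jacobian.galoisCover_pullback_isWeilPairingAdjoint_norm)
    -- the K-level pieces, their monomorphic cofan legs, Jacobians, fan legs and thetas
    {CK : Type*} {XK : SchemeOver ℂ} {EK : CK → SchemeOver ℂ} (eK : ∀ c, EK c ⟶ XK) [∀ c, Mono (eK c)]
    (JK : ∀ c, Jacobian (EK c)) {YK : AbelianVariety ℂ} (πK : ∀ c, YK ⟶ (JK c).J) (ιK : ∀ c, (JK c).J ⟶ YK)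
    (WK : ∀ c, CartierDivisor (JK c).J.X.left)
    -- the indices: `a` = target of the `T_γ`-piece (row of the brick), `d` = source of the `u`-piece (column of the brick)
    {a₁ a₂ d₁ d₂ : CK} (ha : a₁ = a₂) (hd : d₁ = d₂)
    (hKa : IsSmoothProjective 1 (EK a₂)) (hKd : IsSmoothProjective 1 (EK d₂)) (hda : 1 ≤ (JK a₂).J.dim) (hdd : 1 ≤ (JK d₂).J.dim)
    (hWa : (JK a₂).IsRiemannThetaDivisor (WK a₂) ∧ (JK a₂).J.IsPrincipalPolarizationDivisor (WK a₂))
    (hWd : (JK d₂).IsRiemannThetaDivisor (WK d₂) ∧ (JK d₂).J.IsPrincipalPolarizationDivisor (WK d₂))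
    -- the N-piece `X_c` and the N″-piece `X_z`
    {Xc Xz : SchemeOver ℂ} (hc : IsSmoothProjective 1 Xc) (hz : IsSmoothProjective 1 Xz) (𝒥c : Jacobian Xc) (𝒥z : Jacobian Xz)
    (hdc : 1 ≤ 𝒥c.J.dim) {Wc : CartierDivisor 𝒥c.J.X.left} {Wz : CartierDivisor 𝒥z.J.X.left}
    (hWc : 𝒥c.IsRiemannThetaDivisor Wc ∧ 𝒥c.J.IsPrincipalPolarizationDivisor Wc)
    (hWz : 𝒥z.IsRiemannThetaDivisor Wz ∧ 𝒥z.J.IsPrincipalPolarizationDivisor Wz)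
    -- the `u`-piece `tu : X_c → E_K d₂` (Galois `H_u`) with its pinned pull-back `ttH`
    {Hu : Subgroup (Aut Xc)} [Finite Hu] (tu : Xc ⟶ EK d₂) (hqu : IsSepQuotient (fun h : ↥Hu => (h : Aut Xc)) tu)
    (ttH : (JK d₂).J ⟶ 𝒥c.J)
    (httH : letI := Fintype.ofFinite ↥Hu;
      𝒥c.pushforward (JK d₂) tu ≫ ttH = ∑ h : ↥Hu, 𝒥c.pushforward 𝒥c (h : Aut Xc).hom)
    -- the `q′`-piece `q : X_z → X_c` (Galois `H_q`) and the `T_γ`-piece `tp : X_c → E_K a₂`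
    {Hq : Subgroup (Aut Xz)} [Finite Hq] (q : Xz ⟶ Xc) (hqq : IsSepQuotient (fun h : ↥Hq => (h : Aut Xz)) q)
    (tp : Xc ⟶ EK a₂)
    -- the brick's `u″`-piece `p₁ : X_z → E_K a₁` (Galois `H_z`, quotient) with its pinned row `x₁`, over the same ambient map as `q ≫ tp`
    {Hz : Subgroup (Aut Xz)} [Finite Hz] (p₁ : Xz ⟶ EK a₁) (hqz : IsSepQuotient (fun h : ↥Hz => (h : Aut Xz)) p₁)
    (x₁ : (JK a₁).J ⟶ 𝒥z.J)
    (hx₁ : letI := Fintype.ofFinite ↥Hz;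
      𝒥z.pushforward (JK a₁) p₁ ≫ x₁ = ∑ h : ↥Hz, 𝒥z.pushforward 𝒥z (h : Aut Xz).hom)
    (hp : p₁ ≫ eK a₁ = (q ≫ tp) ≫ eK a₂)
    -- the brick's translate piece `r₁ : X_z → E_K d₁`, over the same ambient map as `q ≫ tu`
    (r₁ : Xz ⟶ EK d₁) (hr : r₁ ≫ eK d₁ = (q ≫ tu) ≫ eK d₂)
    -- the trace multiplicity
    (m₀ : ℕ) :
    letI := Fintype.ofFinite ↥Hq
    ∃ fd : (JK a₂).J ⟶ (JK d₂).J,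
      πK a₁ ≫ ((m₀ : ℤ) • (x₁ ≫ 𝒥z.pushforward (JK d₁) r₁)) ≫ ιK d₁ = πK a₂ ≫ fd ≫ ιK d₂ ∧
      ∀ (n : ℕ) [IsDominant (Hom.toSchemeHom ((n : ℤ) • 𝟙 (JK d₂).J))] [IsDominant (Hom.toSchemeHom ((n : ℤ) • 𝟙 (JK a₂).J))]
        (P : (JK d₂).J.torsionPoints ℂ n) (Q : (JK a₂).J.torsionPoints ℂ n),
        (JK a₂).J.weilPairingLevel (WK a₂)
            ⟨AlgPoints.map (((Fintype.card ↥Hq : ℕ) : ℤ) • (((m₀ : ℤ) • ttH) ≫ 𝒥c.pushforward (JK a₂) tp)).hom.hom.hom P.1,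
              map_mem_torsionPoints (((Fintype.card ↥Hq : ℕ) : ℤ) • (((m₀ : ℤ) • ttH) ≫ 𝒥c.pushforward (JK a₂) tp)) P.2⟩ Q =
          (JK d₂).J.weilPairingLevel (WK d₂) P ⟨AlgPoints.map fd.hom.hom.hom Q.1, map_mem_torsionPoints fd Q.2⟩ := by
  letI := Fintype.ofFinite ↥Hq
  letI := Fintype.ofFinite ↥Hz
  -- the quotient property of the `u″`-piece transported to `q ≫ tp : X_z → E_K a₂`
  have hqz' : IsSepQuotient (fun h : ↥Hz => (h : Aut Xz)) (q ≫ tp) :=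
    isSepQuotient_pieceMap_of_index_eq eK (fun h : ↥Hz => (h : Aut Xz)) ha p₁ (q ≫ tp) hp hqz
  -- ★ ed. 2: the pinned pull-back `tz` of `q ≫ tp` and the pair of raw weight `#H_q`
  obtain ⟨tz, htz, hadj⟩ := Jacobian.exists_entry_levelAdjoint_smul hFP2 hKd hc hz hKa (JK d₂) 𝒥c 𝒥z (JK a₂) hdd hdc hda
    tu hqu q hqq (q ≫ tp) hqz' tp rfl hWd hWc hWz hWa ttH httH m₀
  refine ⟨(m₀ : ℤ) • (tz ≫ 𝒥z.pushforward 𝒥c q ≫ 𝒥c.pushforward (JK d₂) tu), ?_, fun n _ _ P Q => hadj n P Q⟩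
  -- the brick's entry IS `fd`: common pin `Σ_{h ∈ H_z} h_*`, same ambient maps, equal indices
  obtain ⟨P₀⟩ := hz.nonempty_algPoints ℂ
  have key := fan_entry_eq_of_pinned_of_index_eq_smul eK JK πK ιK 𝒥z (fun h : ↥Hz => (h : Aut Xz)) P₀ ha p₁ (q ≫ tp) hp hqz'
    x₁ tz hx₁ htz hd r₁ (q ≫ tu) hr (m₀ : ℤ)
  rw [zsmul_comp_pushforward_eq] at key
  rw [key, ← Jacobian.pushforward_comp]

end Literature.NumberTheory.Automorphic.Liu2021.AppendixC

end

/-! ## §2 (edition 2) The entry package in the MULTIPLICITY-ONE regime (plain pinned pull-back `ttH`, no trace multiplicity) -/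

noncomputable section

open CategoryTheory AlgebraicGeometry
open Literature.AlgebraicGeometry.Motives Literature.AlgebraicGeometry.Motives.AbelianVariety

namespace Literature.NumberTheory.Automorphic.Liu2021.AppendixC

/-- **ONE ENTRY OF THE TRANSPOSED HECKE WORD, PACKAGED — multiplicity one** (edition 2; the regime of ★
`exists_fan_traceWord_of_rigid_injective`: faithful deck groups, piecewise rigidity, so the trace words carry the plain pinned pull-backs).
Same data as `Jacobian.exists_entry_package` without `m₀`; then `∃ fd : J_K a₂ → J_K d₂` with
`πY_K a₁ ≫ (x₁ ≫ Nm_{r₁}) ≫ ιY_K d₁ = πY_K a₂ ≫ fd ≫ ιY_K d₂` and `ē_n^{W_K a₂}((#H_q • (ttH ≫ Nm_{tp})) P, Q) = ē_n^{W_K d₂}(P, fd Q)` —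
`fd := tz ≫ Nm_q ≫ Nm_{tu}` (★ `Jacobian.exists_entry_levelAdjoint`, ★ `fan_entry_eq_of_pinned_of_index_eq`).
[cite: MumfordAV1970, §20 (p. 186, property (3) of e_n)] [cite: LangeRodriguez2022, §3.2.1 eq. (3.3) (pp. 46–47); §3.5.1 Prop. 3.5.1 (p. 65)]
[cite: Lange2023AbelianVarietiesComplex, §4.5.2 (the norm map N_f)] [cite: GortzWedhorn2020, §(3.5) Proposition 3.10 and Example 3.11 (p. 73)] -/
theorem Jacobian.exists_entry_package_one (hFP2 : Jacobian.galoisCover_pullback_isWeilPairingAdjoint_norm)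
    {CK : Type*} {XK : SchemeOver ℂ} {EK : CK → SchemeOver ℂ} (eK : ∀ c, EK c ⟶ XK) [∀ c, Mono (eK c)]
    (JK : ∀ c, Jacobian (EK c)) {YK : AbelianVariety ℂ} (πK : ∀ c, YK ⟶ (JK c).J) (ιK : ∀ c, (JK c).J ⟶ YK)
    (WK : ∀ c, CartierDivisor (JK c).J.X.left)
    {a₁ a₂ d₁ d₂ : CK} (ha : a₁ = a₂) (hd : d₁ = d₂)
    (hKa : IsSmoothProjective 1 (EK a₂)) (hKd : IsSmoothProjective 1 (EK d₂)) (hda : 1 ≤ (JK a₂).J.dim) (hdd : 1 ≤ (JK d₂).J.dim)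
    (hWa : (JK a₂).IsRiemannThetaDivisor (WK a₂) ∧ (JK a₂).J.IsPrincipalPolarizationDivisor (WK a₂))
    (hWd : (JK d₂).IsRiemannThetaDivisor (WK d₂) ∧ (JK d₂).J.IsPrincipalPolarizationDivisor (WK d₂))
    {Xc Xz : SchemeOver ℂ} (hc : IsSmoothProjective 1 Xc) (hz : IsSmoothProjective 1 Xz) (𝒥c : Jacobian Xc) (𝒥z : Jacobian Xz)
    (hdc : 1 ≤ 𝒥c.J.dim) {Wc : CartierDivisor 𝒥c.J.X.left} {Wz : CartierDivisor 𝒥z.J.X.left}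
    (hWc : 𝒥c.IsRiemannThetaDivisor Wc ∧ 𝒥c.J.IsPrincipalPolarizationDivisor Wc)
    (hWz : 𝒥z.IsRiemannThetaDivisor Wz ∧ 𝒥z.J.IsPrincipalPolarizationDivisor Wz)
    {Hu : Subgroup (Aut Xc)} [Finite Hu] (tu : Xc ⟶ EK d₂) (hqu : IsSepQuotient (fun h : ↥Hu => (h : Aut Xc)) tu)
    (ttH : (JK d₂).J ⟶ 𝒥c.J)
    (httH : letI := Fintype.ofFinite ↥Hu;
      𝒥c.pushforward (JK d₂) tu ≫ ttH = ∑ h : ↥Hu, 𝒥c.pushforward 𝒥c (h : Aut Xc).hom)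
    {Hq : Subgroup (Aut Xz)} [Finite Hq] (q : Xz ⟶ Xc) (hqq : IsSepQuotient (fun h : ↥Hq => (h : Aut Xz)) q)
    (tp : Xc ⟶ EK a₂)
    {Hz : Subgroup (Aut Xz)} [Finite Hz] (p₁ : Xz ⟶ EK a₁) (hqz : IsSepQuotient (fun h : ↥Hz => (h : Aut Xz)) p₁)
    (x₁ : (JK a₁).J ⟶ 𝒥z.J)
    (hx₁ : letI := Fintype.ofFinite ↥Hz;
      𝒥z.pushforward (JK a₁) p₁ ≫ x₁ = ∑ h : ↥Hz, 𝒥z.pushforward 𝒥z (h : Aut Xz).hom)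
    (hp : p₁ ≫ eK a₁ = (q ≫ tp) ≫ eK a₂)
    (r₁ : Xz ⟶ EK d₁) (hr : r₁ ≫ eK d₁ = (q ≫ tu) ≫ eK d₂) :
    letI := Fintype.ofFinite ↥Hq
    ∃ fd : (JK a₂).J ⟶ (JK d₂).J,
      πK a₁ ≫ (x₁ ≫ 𝒥z.pushforward (JK d₁) r₁) ≫ ιK d₁ = πK a₂ ≫ fd ≫ ιK d₂ ∧
      ∀ (n : ℕ) [IsDominant (Hom.toSchemeHom ((n : ℤ) • 𝟙 (JK d₂).J))] [IsDominant (Hom.toSchemeHom ((n : ℤ) • 𝟙 (JK a₂).J))]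
        (P : (JK d₂).J.torsionPoints ℂ n) (Q : (JK a₂).J.torsionPoints ℂ n),
        (JK a₂).J.weilPairingLevel (WK a₂)
            ⟨AlgPoints.map (((Fintype.card ↥Hq : ℕ) : ℤ) • (ttH ≫ 𝒥c.pushforward (JK a₂) tp)).hom.hom.hom P.1,
              map_mem_torsionPoints (((Fintype.card ↥Hq : ℕ) : ℤ) • (ttH ≫ 𝒥c.pushforward (JK a₂) tp)) P.2⟩ Q =
          (JK d₂).J.weilPairingLevel (WK d₂) P ⟨AlgPoints.map fd.hom.hom.hom Q.1, map_mem_torsionPoints fd Q.2⟩ := by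
  letI := Fintype.ofFinite ↥Hq
  letI := Fintype.ofFinite ↥Hz
  have hqz' : IsSepQuotient (fun h : ↥Hz => (h : Aut Xz)) (q ≫ tp) :=
    isSepQuotient_pieceMap_of_index_eq eK (fun h : ↥Hz => (h : Aut Xz)) ha p₁ (q ≫ tp) hp hqz
  obtain ⟨tz, htz, hadj⟩ := Jacobian.exists_entry_levelAdjoint hFP2 hKd hc hz hKa (JK d₂) 𝒥c 𝒥z (JK a₂) hdd hdc hda
    tu hqu q hqq (q ≫ tp) hqz' tp rfl hWd hWc hWz hWa ttH httH
  refine ⟨tz ≫ 𝒥z.pushforward 𝒥c q ≫ 𝒥c.pushforward (JK d₂) tu, ?_, fun n _ _ P Q => hadj n P Q⟩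
  obtain ⟨P₀⟩ := hz.nonempty_algPoints ℂ
  have key := fan_entry_eq_of_pinned_of_index_eq eK JK πK ιK 𝒥z (fun h : ↥Hz => (h : Aut Xz)) P₀ ha p₁ (q ≫ tp) hp hqz'
    x₁ tz hx₁ htz hd r₁ (q ≫ tu) hr
  rw [key, ← Jacobian.pushforward_comp]

end Literature.NumberTheory.Automorphic.Liu2021.AppendixC

end

/-! ## §3 (edition 3) The entry package with the BRICK-SIDE multiplicity only (plain `ttH` on the forward entry, constant `m₀″` on the
transposed row) -/

noncomputable section

open CategoryTheory AlgebraicGeometry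
open Literature.AlgebraicGeometry.Motives Literature.AlgebraicGeometry.Motives.AbelianVariety

namespace Literature.NumberTheory.Automorphic.Liu2021.AppendixC

/-- Reshaping a doubly weighted torsion point: `(a : ℤ) • ((b : ℤ) • f)` and `((a * b : ℕ) : ℤ) • f` give the same point (bilinearity
of `Hom(X, Y)`). [cite: MumfordAV1970, §19 (Hom(X,Y), first paragraph)] -/
private theorem torsionPoints_map_smul_smul_eq {L : Type} [Field L] {A B : AbelianVariety L} (f : A ⟶ B) (a b : ℕ) {n : ℕ}
    (P : A.torsionPoints L n) :
    (⟨AlgPoints.map ((a : ℤ) • ((b : ℤ) • f)).hom.hom.hom P.1, map_mem_torsionPoints ((a : ℤ) • ((b : ℤ) • f)) P.2⟩ :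
        B.torsionPoints L n) =
      ⟨AlgPoints.map (((a * b : ℕ) : ℤ) • f).hom.hom.hom P.1, map_mem_torsionPoints (((a * b : ℕ) : ℤ) • f) P.2⟩ :=
  Subtype.ext (by rw [smul_smul, Nat.cast_mul])

/-- **ONE ENTRY OF THE TRANSPOSED HECKE WORD, PACKAGED — forward entry of multiplicity one, transposed row of constant multiplicity
`m₀″`** (edition 3; the regime «(hx) side faithful (★ `exists_fan_traceWord_of_rigid_injective`), brick side with the constant deck-kernel
multiplicity (★ `exists_fan_traceWord_of_rigid`)»).  Same data as `Jacobian.exists_entry_package_one` plus `m₀″ : ℕ`; then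
`∃ fd : J_K a₂ → J_K d₂` with `πY_K a₁ ≫ ((m₀″:ℤ) • (x₁ ≫ Nm_{r₁})) ≫ ιY_K d₁ = πY_K a₂ ≫ fd ≫ ιY_K d₂` and the pair
`ē_n^{W_K a₂}(((#H_q·m₀″) • (ttH ≫ Nm_{tp})) P, Q) = ē_n^{W_K d₂}(P, fd Q)` (raw weight `#H_q · m₀″`; `fd := (m₀″:ℤ) • fd₁` for the `fd₁` of
edition 2, ★ `levelAdjoint_nsmul`). [cite: MumfordAV1970, §20 (p. 186, property (3) of e_n)]
[cite: LangeRodriguez2022, §3.2.1 eq. (3.3) (pp. 46–47); §3.5.1 Prop. 3.5.1 (p. 65)] [cite: Lange2023AbelianVarietiesComplex, §4.5.2 (the norm map N_f)] -/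
theorem Jacobian.exists_entry_package_brickMult (hFP2 : Jacobian.galoisCover_pullback_isWeilPairingAdjoint_norm)
    {CK : Type*} {XK : SchemeOver ℂ} {EK : CK → SchemeOver ℂ} (eK : ∀ c, EK c ⟶ XK) [∀ c, Mono (eK c)]
    (JK : ∀ c, Jacobian (EK c)) {YK : AbelianVariety ℂ} (πK : ∀ c, YK ⟶ (JK c).J) (ιK : ∀ c, (JK c).J ⟶ YK)
    (WK : ∀ c, CartierDivisor (JK c).J.X.left)
    {a₁ a₂ d₁ d₂ : CK} (ha : a₁ = a₂) (hd : d₁ = d₂)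
    (hKa : IsSmoothProjective 1 (EK a₂)) (hKd : IsSmoothProjective 1 (EK d₂)) (hda : 1 ≤ (JK a₂).J.dim) (hdd : 1 ≤ (JK d₂).J.dim)
    (hWa : (JK a₂).IsRiemannThetaDivisor (WK a₂) ∧ (JK a₂).J.IsPrincipalPolarizationDivisor (WK a₂))
    (hWd : (JK d₂).IsRiemannThetaDivisor (WK d₂) ∧ (JK d₂).J.IsPrincipalPolarizationDivisor (WK d₂))
    {Xc Xz : SchemeOver ℂ} (hc : IsSmoothProjective 1 Xc) (hz : IsSmoothProjective 1 Xz) (𝒥c : Jacobian Xc) (𝒥z : Jacobian Xz)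
    (hdc : 1 ≤ 𝒥c.J.dim) {Wc : CartierDivisor 𝒥c.J.X.left} {Wz : CartierDivisor 𝒥z.J.X.left}
    (hWc : 𝒥c.IsRiemannThetaDivisor Wc ∧ 𝒥c.J.IsPrincipalPolarizationDivisor Wc)
    (hWz : 𝒥z.IsRiemannThetaDivisor Wz ∧ 𝒥z.J.IsPrincipalPolarizationDivisor Wz)
    {Hu : Subgroup (Aut Xc)} [Finite Hu] (tu : Xc ⟶ EK d₂) (hqu : IsSepQuotient (fun h : ↥Hu => (h : Aut Xc)) tu)
    (ttH : (JK d₂).J ⟶ 𝒥c.J)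
    (httH : letI := Fintype.ofFinite ↥Hu;
      𝒥c.pushforward (JK d₂) tu ≫ ttH = ∑ h : ↥Hu, 𝒥c.pushforward 𝒥c (h : Aut Xc).hom)
    {Hq : Subgroup (Aut Xz)} [Finite Hq] (q : Xz ⟶ Xc) (hqq : IsSepQuotient (fun h : ↥Hq => (h : Aut Xz)) q)
    (tp : Xc ⟶ EK a₂)
    {Hz : Subgroup (Aut Xz)} [Finite Hz] (p₁ : Xz ⟶ EK a₁) (hqz : IsSepQuotient (fun h : ↥Hz => (h : Aut Xz)) p₁)
    (x₁ : (JK a₁).J ⟶ 𝒥z.J)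
    (hx₁ : letI := Fintype.ofFinite ↥Hz;
      𝒥z.pushforward (JK a₁) p₁ ≫ x₁ = ∑ h : ↥Hz, 𝒥z.pushforward 𝒥z (h : Aut Xz).hom)
    (hp : p₁ ≫ eK a₁ = (q ≫ tp) ≫ eK a₂)
    (r₁ : Xz ⟶ EK d₁) (hr : r₁ ≫ eK d₁ = (q ≫ tu) ≫ eK d₂) (m₀'' : ℕ) :
    letI := Fintype.ofFinite ↥Hq
    ∃ fd : (JK a₂).J ⟶ (JK d₂).J,
      πK a₁ ≫ ((m₀'' : ℤ) • (x₁ ≫ 𝒥z.pushforward (JK d₁) r₁)) ≫ ιK d₁ = πK a₂ ≫ fd ≫ ιK d₂ ∧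
      ∀ (n : ℕ) [IsDominant (Hom.toSchemeHom ((n : ℤ) • 𝟙 (JK d₂).J))] [IsDominant (Hom.toSchemeHom ((n : ℤ) • 𝟙 (JK a₂).J))]
        (P : (JK d₂).J.torsionPoints ℂ n) (Q : (JK a₂).J.torsionPoints ℂ n),
        (JK a₂).J.weilPairingLevel (WK a₂)
            ⟨AlgPoints.map (((Fintype.card ↥Hq * m₀'' : ℕ) : ℤ) • (ttH ≫ 𝒥c.pushforward (JK a₂) tp)).hom.hom.hom P.1,
              map_mem_torsionPoints (((Fintype.card ↥Hq * m₀'' : ℕ) : ℤ) • (ttH ≫ 𝒥c.pushforward (JK a₂) tp)) P.2⟩ Q =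
          (JK d₂).J.weilPairingLevel (WK d₂) P ⟨AlgPoints.map fd.hom.hom.hom Q.1, map_mem_torsionPoints fd Q.2⟩ := by
  letI := Fintype.ofFinite ↥Hq
  obtain ⟨fd₁, hfd₁, hadj⟩ := Jacobian.exists_entry_package_one hFP2 eK JK πK ιK WK ha hd hKa hKd hda hdd hWa hWd hc hz 𝒥c 𝒥z hdc
    hWc hWz tu hqu ttH httH q hqq tp p₁ hqz x₁ hx₁ hp r₁ hr
  refine ⟨(m₀'' : ℤ) • fd₁, ?_, fun n _ _ P Q => ?_⟩
  · rw [Preadditive.zsmul_comp, Preadditive.comp_zsmul, hfd₁, ← Preadditive.comp_zsmul, ← Preadditive.zsmul_comp]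
  · rw [← torsionPoints_map_smul_smul_eq]
    exact levelAdjoint_nsmul (WK d₂) (WK a₂) hadj m₀'' n P Q

end Literature.NumberTheory.Automorphic.Liu2021.AppendixC

end

/-! ## §4 (edition 4) The entry package WITHOUT genus hypotheses: Riemann data guarded by `1 ≤ dim`, degenerate entries vanish -/

noncomputable section

open CategoryTheory AlgebraicGeometry
open Literature.AlgebraicGeometry.Motives Literature.AlgebraicGeometry.Motives.AbelianVariety

namespace Literature.NumberTheory.Automorphic.Liu2021.AppendixC

/-- The point of `B` under the zero homomorphism is the origin. [cite: MumfordAV1970, §19 (Hom(X,Y), first paragraph)] -/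
private theorem torsionPoints_map_zero_eq_one {L : Type} [Field L] {A B : AbelianVariety L} {n : ℕ} (w : ℤ)
    (P : A.torsionPoints L n) :
    (⟨AlgPoints.map (w • (0 : A ⟶ B)).hom.hom.hom P.1, map_mem_torsionPoints (w • (0 : A ⟶ B)) P.2⟩ : B.torsionPoints L n) = 1 := by
  apply Subtype.ext
  change AlgPoints.map (w • (0 : A ⟶ B)).hom.hom.hom P.1 = (1 : B.Points L)
  rw [smul_zero]
  unfold AlgPoints.map
  rw [AbelianVariety.hom_zero]
  simp

/-- The point of `B` under the zero homomorphism is the origin (unweighted). [cite: MumfordAV1970, §19 (Hom(X,Y), first paragraph)] -/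
private theorem torsionPoints_map_zero_eq_one' {L : Type} [Field L] {A B : AbelianVariety L} {n : ℕ} (P : A.torsionPoints L n) :
    (⟨AlgPoints.map (0 : A ⟶ B).hom.hom.hom P.1, map_mem_torsionPoints (0 : A ⟶ B) P.2⟩ : B.torsionPoints L n) = 1 := by
  apply Subtype.ext
  change AlgPoints.map (0 : A ⟶ B).hom.hom.hom P.1 = (1 : B.Points L)
  unfold AlgPoints.map
  rw [AbelianVariety.hom_zero]
  simp

/-- **A Galois quotient of a curve whose Jacobian is a point has a target whose Jacobian is a point**: if `q : X_z → X_c` is a quotient by a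
finite group for separated test objects (with a point of `X_z`), then `Nm_q` is right-cancellable (★ `Jacobian.eq_of_pushforward_comp_eq`), so
`dim J_z = 0` forces `𝟙_{J_c} = 0`, impossible for `dim J_c ≥ 1` (`[1]` is dominant on a positive-dimensional abelian variety, ★
`natCast_ne_zero_of_isDominant_zsmul`). [cite: LangeRodriguez2022, §3.5.1 Prop. 3.5.1 (p. 65)] [cite: MumfordAV1970, §6 Proposition p. 64] -/
theorem Jacobian.one_le_dim_of_isSepQuotient {Xc Xz : SchemeOver ℂ} (𝒥c : Jacobian Xc) (𝒥z : Jacobian Xz) {Δ : Type*}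
    (act : Δ → (Xz ≅ Xz)) (q : Xz ⟶ Xc) (hq : IsSepQuotient act q) (P₀ : AlgPoints Xz ℂ) (hdc : 1 ≤ 𝒥c.J.dim) :
    1 ≤ 𝒥z.J.dim := by
  by_contra hz0
  have hz : 𝒥z.J.dim = 0 := by omega
  have h0 : 𝒥z.pushforward 𝒥c q = 0 := hom_eq_zero_of_dim_eq_zero_left 𝒥z.J hz _
  have h10 : (𝟙 𝒥c.J : 𝒥c.J ⟶ 𝒥c.J) = 0 :=
    𝒥z.eq_of_pushforward_comp_eq 𝒥c act q hq P₀ (by rw [h0, Limits.zero_comp, Limits.zero_comp])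
  have hd : IsDominant (Hom.toSchemeHom (((0 : ℕ) : ℤ) • 𝟙 𝒥c.J)) := by
    have h1 := isDominant_toSchemeHom_zsmul_of_ne_zero 𝒥c.J (N := 1) (by norm_num)
    rwa [show ((1 : ℕ) : ℤ) • 𝟙 𝒥c.J = ((0 : ℕ) : ℤ) • 𝟙 𝒥c.J by rw [Nat.cast_one, one_smul, Nat.cast_zero, zero_smul, h10]] at h1
  exact natCast_ne_zero_of_isDominant_zsmul 𝒥c.J hdc 0 rfl

/-- **ONE ENTRY OF THE TRANSPOSED HECKE WORD, PACKAGED, WITHOUT GENUS HYPOTHESES** (edition 4; the consumer form of the d6 glue).  As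
`Jacobian.exists_entry_package_brickMult`, but the Riemann/principality data on the four Jacobians are only assumed in positive dimension
(`1 ≤ dim → …`, the shape delivered by ★ `Albanese.exists_complexJacobian_biproduct_theta_cofan`), and no dimension hypothesis is made:
if one of `J_K d₂`, `J_c`, `J_K a₂` is a point the forward entry `ttH ≫ Nm_{tp}` and the brick's entry both vanish and `fd := 0` does it
(`ē(1, Q) = 1 = ē(P, 1)`); otherwise `J_z` has positive dimension too (`Jacobian.one_le_dim_of_isSepQuotient`) and edition 3 applies.
[cite: MumfordAV1970, §20 (p. 186, property (3) of e_n); §19 (Hom(X,Y), first paragraph)]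
[cite: LangeRodriguez2022, §3.2.1 eq. (3.3) (pp. 46–47); §3.5.1 Prop. 3.5.1 (p. 65)] -/
theorem Jacobian.exists_entry_package_guarded (hFP2 : Jacobian.galoisCover_pullback_isWeilPairingAdjoint_norm)
    {CK : Type*} {XK : SchemeOver ℂ} {EK : CK → SchemeOver ℂ} (eK : ∀ c, EK c ⟶ XK) [∀ c, Mono (eK c)]
    (JK : ∀ c, Jacobian (EK c)) {YK : AbelianVariety ℂ} (πK : ∀ c, YK ⟶ (JK c).J) (ιK : ∀ c, (JK c).J ⟶ YK)
    (WK : ∀ c, CartierDivisor (JK c).J.X.left)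
    {a₁ a₂ d₁ d₂ : CK} (ha : a₁ = a₂) (hd : d₁ = d₂)
    (hKa : IsSmoothProjective 1 (EK a₂)) (hKd : IsSmoothProjective 1 (EK d₂))
    (hWa : 1 ≤ (JK a₂).J.dim → (JK a₂).IsRiemannThetaDivisor (WK a₂) ∧ (JK a₂).J.IsPrincipalPolarizationDivisor (WK a₂))
    (hWd : 1 ≤ (JK d₂).J.dim → (JK d₂).IsRiemannThetaDivisor (WK d₂) ∧ (JK d₂).J.IsPrincipalPolarizationDivisor (WK d₂))
    {Xc Xz : SchemeOver ℂ} (hc : IsSmoothProjective 1 Xc) (hz : IsSmoothProjective 1 Xz) (𝒥c : Jacobian Xc) (𝒥z : Jacobian Xz)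
    {Wc : CartierDivisor 𝒥c.J.X.left} {Wz : CartierDivisor 𝒥z.J.X.left}
    (hWc : 1 ≤ 𝒥c.J.dim → 𝒥c.IsRiemannThetaDivisor Wc ∧ 𝒥c.J.IsPrincipalPolarizationDivisor Wc)
    (hWz : 1 ≤ 𝒥z.J.dim → 𝒥z.IsRiemannThetaDivisor Wz ∧ 𝒥z.J.IsPrincipalPolarizationDivisor Wz)
    {Hu : Subgroup (Aut Xc)} [Finite Hu] (tu : Xc ⟶ EK d₂) (hqu : IsSepQuotient (fun h : ↥Hu => (h : Aut Xc)) tu)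
    (ttH : (JK d₂).J ⟶ 𝒥c.J)
    (httH : letI := Fintype.ofFinite ↥Hu;
      𝒥c.pushforward (JK d₂) tu ≫ ttH = ∑ h : ↥Hu, 𝒥c.pushforward 𝒥c (h : Aut Xc).hom)
    {Hq : Subgroup (Aut Xz)} [Finite Hq] (q : Xz ⟶ Xc) (hqq : IsSepQuotient (fun h : ↥Hq => (h : Aut Xz)) q)
    (tp : Xc ⟶ EK a₂)
    {Hz : Subgroup (Aut Xz)} [Finite Hz] (p₁ : Xz ⟶ EK a₁) (hqz : IsSepQuotient (fun h : ↥Hz => (h : Aut Xz)) p₁)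
    (x₁ : (JK a₁).J ⟶ 𝒥z.J)
    (hx₁ : letI := Fintype.ofFinite ↥Hz;
      𝒥z.pushforward (JK a₁) p₁ ≫ x₁ = ∑ h : ↥Hz, 𝒥z.pushforward 𝒥z (h : Aut Xz).hom)
    (hp : p₁ ≫ eK a₁ = (q ≫ tp) ≫ eK a₂)
    (r₁ : Xz ⟶ EK d₁) (hr : r₁ ≫ eK d₁ = (q ≫ tu) ≫ eK d₂) (m₀'' : ℕ) :
    letI := Fintype.ofFinite ↥Hq
    ∃ fd : (JK a₂).J ⟶ (JK d₂).J,
      πK a₁ ≫ ((m₀'' : ℤ) • (x₁ ≫ 𝒥z.pushforward (JK d₁) r₁)) ≫ ιK d₁ = πK a₂ ≫ fd ≫ ιK d₂ ∧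
      ∀ (n : ℕ) [IsDominant (Hom.toSchemeHom ((n : ℤ) • 𝟙 (JK d₂).J))] [IsDominant (Hom.toSchemeHom ((n : ℤ) • 𝟙 (JK a₂).J))]
        (P : (JK d₂).J.torsionPoints ℂ n) (Q : (JK a₂).J.torsionPoints ℂ n),
        (JK a₂).J.weilPairingLevel (WK a₂)
            ⟨AlgPoints.map (((Fintype.card ↥Hq * m₀'' : ℕ) : ℤ) • (ttH ≫ 𝒥c.pushforward (JK a₂) tp)).hom.hom.hom P.1,
              map_mem_torsionPoints (((Fintype.card ↥Hq * m₀'' : ℕ) : ℤ) • (ttH ≫ 𝒥c.pushforward (JK a₂) tp)) P.2⟩ Q =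
          (JK d₂).J.weilPairingLevel (WK d₂) P ⟨AlgPoints.map fd.hom.hom.hom Q.1, map_mem_torsionPoints fd Q.2⟩ := by
  letI := Fintype.ofFinite ↥Hq
  -- the translate piece `r₁` is `q ≫ tu` (monomorphic legs, `d₁ = d₂`)
  subst ha hd
  have hr' : r₁ = q ≫ tu := (cancel_mono (eK d₁)).1 hr
  by_cases hdeg : (JK d₁).J.dim = 0 ∨ 𝒥c.J.dim = 0 ∨ (JK a₁).J.dim = 0
  · -- degenerate entries: the forward entry and the brick's entry vanish, `fd := 0`
    have hf0 : ttH ≫ 𝒥c.pushforward (JK a₁) tp = 0 := by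
      rcases hdeg with h | h | h
      · exact hom_eq_zero_of_dim_eq_zero_left (JK d₁).J h _
      · rw [hom_eq_zero_of_dim_eq_zero_left 𝒥c.J h (𝒥c.pushforward (JK a₁) tp), Limits.comp_zero]
      · exact hom_eq_zero_of_dim_eq_zero_right (JK a₁).J h _
    have he0 : πK a₁ ≫ ((m₀'' : ℤ) • (x₁ ≫ 𝒥z.pushforward (JK d₁) r₁)) ≫ ιK d₁ = 0 := by
      rcases hdeg with h | h | h
      · rw [hom_eq_zero_of_dim_eq_zero_left (JK d₁).J h (ιK d₁), Limits.comp_zero, Limits.comp_zero]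
      · rw [hr', Jacobian.pushforward_comp, hom_eq_zero_of_dim_eq_zero_left 𝒥c.J h (𝒥c.pushforward (JK d₁) tu),
          Limits.comp_zero, Limits.comp_zero, smul_zero, Limits.zero_comp, Limits.comp_zero]
      · rw [hom_eq_zero_of_dim_eq_zero_right (JK a₁).J h (πK a₁), Limits.zero_comp]
    refine ⟨0, ?_, fun n _ _ P Q => ?_⟩
    · rw [he0, Limits.zero_comp, Limits.comp_zero]
    · rw [hf0, torsionPoints_map_zero_eq_one, torsionPoints_map_zero_eq_one', weilPairingLevel_one_left,
        weilPairingLevel_one_right]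
  · -- non-degenerate: all four Jacobians have positive dimension, edition 3 applies
    push Not at hdeg
    obtain ⟨hd0, hc0, ha0⟩ := hdeg
    have hdd : 1 ≤ (JK d₁).J.dim := Nat.one_le_iff_ne_zero.mpr hd0
    have hdc : 1 ≤ 𝒥c.J.dim := Nat.one_le_iff_ne_zero.mpr hc0
    have hda : 1 ≤ (JK a₁).J.dim := Nat.one_le_iff_ne_zero.mpr ha0
    obtain ⟨P₀⟩ := hz.nonempty_algPoints ℂ
    have hdz : 1 ≤ 𝒥z.J.dim := Jacobian.one_le_dim_of_isSepQuotient 𝒥c 𝒥z (fun h : ↥Hq => (h : Aut Xz)) q hqq P₀ hdc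
    exact Jacobian.exists_entry_package_brickMult hFP2 eK JK πK ιK WK rfl rfl hKa hKd hda hdd (hWa hda) (hWd hdd) hc hz 𝒥c 𝒥z
      hdc (hWc hdc) (hWz hdz) tu hqu ttH httH q hqq tp p₁ hqz x₁ hx₁ hp r₁ hr m₀''

end Literature.NumberTheory.Automorphic.Liu2021.AppendixC

end
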